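import Summits.CriticalPhenomena.CardyFormulaZ2.Theorems.CardyBoundaryCoulombGasHalfPlaneMarkDensityLawFirstHitPredDet

/-!
# `HalfPlaneMarkDensityLaw` (crux stmt-CriticalPhenomena-5661), line `Sketch`, lead c12-0:
# the converse unit-scale surgery for first-hit events — deterministic half, Case II

Sequel of `…FirstHitPredDet.lean` (notation and setting there): on `E(k) = firstHit H A k₀ k` with
`β < k₀`, `k₀ + 1 ≤ k`, if `(k+1,0)` is NOT joined to `A` inside `H ∖ {(k,0)}` (case II), then closing
`e₁ = (k,0)(k+1,0)`, `e₃ = (k,0)(k,1)` and opening `e₄ = (k,1)(k+1,1)`, `e₅ = (k+1,1)(k+1,0)` yields a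
configuration of `E(k+1)` (`caseII_surgery`, registered form `stub_caseII_surgery`).  The joining
path is `A → (k,1)` (case II, `caseII_up`) followed by `e₄, e₅`; that no vertex of `[k₀,k+1)×{0}` gets
joined to `A` reduces, after a path decomposition at `(k+1,1)`, to `not_conn_K_of_closed` and the
planarity consequences `caseII_not_conn_right` of `stub_interleave`.
-/

noncomputable section

namespace Summit.CriticalPhenomena.CardyFormulaZ2.Cruxes.HalfPlaneMarkDensityLaw.SketchLine

open Literature.Probability.Percolation Literature.Probability.LatticeModels
open MeasureTheory Filter Set SimpleGraph
open scoped Topology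
open Summit.CriticalPhenomena.CardyFormulaZ2.Theorems.HalfPlaneMarkDensityLaw.Negative

namespace TwoArmLower

section Setting

variable {ω : BondConfig (Site 2)} {α β k₀ k : ℤ}

/-! ### Case II: the surgery -/

/-- Two unordered pairs differ as soon as they differ as ordered pairs both ways. [folklore] -/
lemma sym2_ne_of {a b c d : Site 2} (h₁ : a ≠ c ∨ b ≠ d) (h₂ : a ≠ d ∨ b ≠ c) : s(a, b) ≠ s(c, d) := by
  intro h
  rw [Sym2.eq_iff] at h
  rcases h with ⟨rfl, rfl⟩ | ⟨rfl, rfl⟩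
  · rcases h₁ with h | h <;> exact h rfl
  · rcases h₂ with h | h <;> exact h rfl

/-- `(k,0) ≠ (k', 1)`-type facts: sites with different second coordinates differ. [folklore] -/
lemma site_ne_of_apply_one {u v : Site 2} (h : u 1 ≠ v 1) : u ≠ v := fun huv => h (by rw [huv])

/-- Sites with different first coordinates differ. [folklore] -/
lemma site_ne_of_apply_zero {u v : Site 2} (h : u 0 ≠ v 0) : u ≠ v := fun huv => h (by rw [huv])

/-- **Case II surgery.** On `E(k)` (`β < k₀`, `k₀ + 1 ≤ k`), if `(k+1,0)` is not joined to `A` inside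
`H ∖ {(k,0)}`, then closing `e₁ = (k,0)(k+1,0)`, `e₃ = (k,0)(k,1)` and opening `e₄ = (k,1)(k+1,1)`,
`e₅ = (k+1,1)(k+1,0)` yields a configuration of `E(k+1)`. [folklore] -/
theorem caseII_surgery (hω : ω ⊆ (zdGraph 2).edgeSet) (hβ : β < k₀) (hk : k₀ + 1 ≤ k)
    (hE : ω ∈ firstHit halfPlane (rowIcc α β) k₀ k)
    (hnI : ω ∉ openCrossing (halfPlane \ {bpt k}) (rowIcc α β) {bpt (k + 1)}) :
    (ω \ {s(bpt k, bpt (k + 1)), s(bpt k, ![k, 1])}) ∪ {s(![k, 1], ![k + 1, 1]), s(![k + 1, 1], bpt (k + 1))} ∈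
      firstHit halfPlane (rowIcc α β) k₀ (k + 1) := by
  classical
  set ω' := (ω \ {s(bpt k, bpt (k + 1)), s(bpt k, ![k, 1])}) ∪ {s(![k, 1], ![k + 1, 1]), s(![k + 1, 1], bpt (k + 1))}
    with hω'def
  -- lattice adjacencies of the two new edges
  have hadj4 : (zdGraph 2).Adj (![k, 1] : Site 2) ![k + 1, 1] := by rw [zdGraph_two_adj_iff]; simp
  have hadj5 : (zdGraph 2).Adj (![k + 1, 1] : Site 2) (bpt (k + 1)) := by rw [zdGraph_two_adj_iff]; simp [bpt]
  have hω' : ω' ⊆ (zdGraph 2).edgeSet := by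
    rintro e (⟨he, -⟩ | he)
    · exact hω he
    · rcases he with rfl | rfl
      · exact (SimpleGraph.mem_edgeSet _).2 hadj4
      · exact (SimpleGraph.mem_edgeSet _).2 hadj5
  -- bookkeeping of the five edges
  have hK1 : (bpt k : Site 2) ≠ ![k, 1] := site_ne_of_apply_one (by simp [bpt])
  have hK1' : (bpt k : Site 2) ≠ ![k + 1, 1] := site_ne_of_apply_one (by simp [bpt])
  have hKr1 : (bpt (k + 1) : Site 2) ≠ ![k + 1, 1] := site_ne_of_apply_one (by simp [bpt])
  have hKr1' : (bpt (k + 1) : Site 2) ≠ ![k, 1] := site_ne_of_apply_one (by simp [bpt])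
  have hKl1 : (bpt (k - 1) : Site 2) ≠ ![k, 1] := site_ne_of_apply_one (by simp [bpt])
  have hKl1' : (bpt (k - 1) : Site 2) ≠ ![k + 1, 1] := site_ne_of_apply_one (by simp [bpt])
  have h1 : s(bpt k, bpt (k + 1)) ∉ ω' := by
    rintro (⟨-, h⟩ | h)
    · exact h (Or.inl rfl)
    · rcases h with h | h
      · exact sym2_ne_of (Or.inl hK1) (Or.inl hK1') h
      · exact sym2_ne_of (Or.inl hK1') (Or.inr hKr1) h
  have h3 : s(bpt k, ![k, 1]) ∉ ω' := by
    rintro (⟨-, h⟩ | h)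
    · exact h (Or.inr rfl)
    · rcases h with h | h
      · exact sym2_ne_of (Or.inl hK1) (Or.inl hK1') h
      · exact sym2_ne_of (Or.inl hK1') (Or.inr (site_ne_of_apply_zero (by simp))) h
  have h2 : s(bpt (k - 1), bpt k) ∈ ω' → s(bpt (k - 1), bpt k) ∈ ω := by
    rintro (⟨h, -⟩ | h)
    · exact h
    · exfalso
      rcases h with h | h
      · exact sym2_ne_of (Or.inl hKl1) (Or.inl hKl1') h
      · exact sym2_ne_of (Or.inl hKl1') (Or.inr hK1') h
  have hsub : ∀ e ∈ ω', e ∉ ({s(![k, 1], ![k + 1, 1]), s(![k + 1, 1], bpt (k + 1))} : Set _) → e ∈ ω := by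
    rintro e (⟨he, -⟩ | he) hne
    · exact he
    · exact absurd he hne
  obtain ⟨⟨x, hx, y, hy, hxu⟩, -⟩ := caseII_up hω hβ hk hE hnI
  obtain rfl : y = ![k, 1] := hy
  constructor
  · -- `A ↔ (k,1)` avoiding `K` in `ω`, then the two new edges
    obtain ⟨p, hpS, hpω⟩ := exists_walk_of_mem_openConnIn hω hxu
    set p' : (zdGraph 2).Walk x (bpt (k + 1)) := p.append (Walk.cons hadj4 (Walk.cons hadj5 Walk.nil)) with hp'
    refine ⟨x, hx, bpt (k + 1), rfl, mem_openConnIn_of_walk p' (fun z hz => ?_) (fun e he => ?_)⟩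
    · rw [hp', Walk.support_append, List.mem_append] at hz
      rcases hz with hz | hz
      · exact (hpS z hz).1
      · simp only [Walk.support_cons, Walk.support_nil, List.tail_cons, List.mem_cons, List.not_mem_nil,
          or_false] at hz
        rcases hz with rfl | rfl
        · show (0 : ℤ) ≤ 1; norm_num
        · show (0 : ℤ) ≤ 0; rfl
    · rw [hp', Walk.edges_append, List.mem_append] at he
      rcases he with he | he
      · left
        refine ⟨hpω e he, ?_⟩
        have hK : bpt k ∉ e := fun hKe => (hpS _ (p.mem_support_of_mem_edges he hKe)).2 rfl
        rintro (rfl | rfl) <;> exact hK (Sym2.mem_mk_left _ _)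
      · right
        simp only [Walk.edges_cons, Walk.edges_nil, List.mem_cons, List.not_mem_nil, or_false] at he
        rcases he with rfl | rfl
        · exact Or.inl rfl
        · exact Or.inr rfl
  · rintro ⟨x', hx', v, ⟨hv1, hv0, hv0'⟩, hxv⟩
    -- the target is not `K`
    rcases lt_or_eq_of_le (Int.lt_add_one_iff.1 hv0') with hvk | hvk
    swap
    · have hv : v = bpt k := (site_eq_bpt_iff v k).2 ⟨hv1, hvk⟩
      rw [hv] at hxv
      exact not_conn_K_of_closed hβ hk hE hω' h1 h3 h2 hx' hxv
    have hvI : v ∈ rowIco k₀ k := ⟨hv1, hv0, hvk⟩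
    -- a path from `x'` to `v` open in `ω'`; it avoids `K`
    obtain ⟨w₀, hw₀S, hw₀ω⟩ := exists_walk_of_mem_openConnIn hω' hxv
    set w := w₀.bypass with hw
    have hwS : ∀ z ∈ w.support, z ∈ halfPlane := fun z hz => hw₀S z (w₀.support_bypass_subset_support hz)
    have hwω : ∀ e ∈ w.edges, e ∈ ω' := fun e he => hw₀ω e (w₀.edges_bypass_subset_edges he)
    have hwpath : w.IsPath := w₀.bypass_isPath
    have hwK : ∀ z ∈ w.support, z ∈ halfPlane \ {bpt k} := by
      intro z hz
      refine ⟨hwS z hz, fun hzK => ?_⟩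
      rw [mem_singleton_iff] at hzK
      subst hzK
      exact not_conn_K_of_closed hβ hk hE hω' h1 h3 h2 hx' (mem_openConnIn_of_mem_support w hwS hwω hz)
    by_cases hKru : (![k + 1, 1] : Site 2) ∈ w.support
    swap
    · -- no new edge is used: the walk is open in `ω`
      refine hE.2 ⟨x', hx', v, hvI, mem_openConnIn_of_walk w hwS fun e he => hsub e (hwω e he) ?_⟩
      rintro (rfl | rfl)
      · exact hKru (w.snd_mem_support_of_mem_edges he)
      · exact hKru (w.fst_mem_support_of_mem_edges he)
    · -- the part of the path after `(k+1,1)`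
      set w₂ := w.dropUntil _ hKru with hw₂
      have hw₂path : w₂.IsPath := hwpath.dropUntil hKru
      have hw₂S : ∀ z ∈ w₂.support, z ∈ halfPlane \ {bpt k} :=
        fun z hz => hwK z (w.support_dropUntil_subset_support hKru hz)
      have hw₂ω : ∀ e ∈ w₂.edges, e ∈ ω' := fun e he => hwω e (w.edges_dropUntil_subset_edges hKru he)
      clear_value w₂
      cases w₂ with
      | nil => simp at hv1
      | cons hadj w₃ =>
        rename_i u
        rw [Walk.cons_isPath_iff] at hw₂path
        have hw₃S : ∀ z ∈ w₃.support, z ∈ halfPlane \ {bpt k} := fun z hz => hw₂S z (by simp [hz])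
        have hw₃ω : ∀ e ∈ w₃.edges, e ∈ ω := by
          intro e he
          refine hsub e (hw₂ω e (by simp [he])) ?_
          rintro (rfl | rfl)
          · exact hw₂path.2 (w₃.snd_mem_support_of_mem_edges he)
          · exact hw₂path.2 (w₃.fst_mem_support_of_mem_edges he)
        have huv : ω ∈ openConnIn (halfPlane \ {bpt k}) u v := mem_openConnIn_of_walk w₃ hw₃S hw₃ω
        have hfirst : s(![k + 1, 1], u) ∈ ω' := hw₂ω _ (by simp)
        by_cases hfirstω : s(![k + 1, 1], u) ∈ ω
        · -- (a) the first edge is open in `ω`: `(k+1,1) ↔ v` in `ω`, against planarity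
          refine (caseII_not_conn_right hω hβ hk hE hnI hvI).2 ?_
          rw [openConnIn_comm]
          exact PlanarDuality.openConnIn_trans
            (openConnIn_of_adj (hw₂S _ (by simp)) (hw₃S u (by simp)) hfirstω hadj.ne) huv
        · -- (b) the first edge is a new edge: `u = (k,1)` or `u = (k+1,0)`
          have hnew : s(![k + 1, 1], u) ∈ ({s(![k, 1], ![k + 1, 1]), s(![k + 1, 1], bpt (k + 1))} : Set _) := by
            rcases hfirst with ⟨h, -⟩ | h
            · exact absurd h hfirstω
            · exact h
          rcases hnew with h | h
          · -- `u = (k,1)`: `v ↔ (k,1) ↔ A` in `ω`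
            have hu : u = ![k, 1] := by
              rcases Sym2.eq_iff.1 h with ⟨h', -⟩ | ⟨-, h'⟩
              · exact absurd (congrFun h' 0) (by simp)
              · exact h'
            subst hu
            exact hE.2 ⟨x, hx, v, hvI, openConnIn_mono (show halfPlane \ {bpt k} ⊆ halfPlane from fun _ h => h.1)
              _ _ (PlanarDuality.openConnIn_trans hxu huv)⟩
          · -- `u = (k+1,0)`: `v ↔ (k+1,0)` in `ω`, against planarity
            have hu : u = bpt (k + 1) := by
              rcases Sym2.eq_iff.1 h with ⟨-, h'⟩ | ⟨h', -⟩
              · exact h'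
              · exact absurd (congrFun h' 1) (by simp [bpt])
            subst hu
            refine (caseII_not_conn_right hω hβ hk hE hnI hvI).1 ?_
            rw [openConnIn_comm]; exact huv



/-! ### Registered form (Case II) -/

/-- **STUB (registered signature): Case II surgery** for the first-hit events of a boundary arc left of
the window. [folklore] -/
theorem stub_caseII_surgery :
    ∀ {ω : BondConfig (Site 2)} {α β k₀ k : ℤ}, ω ⊆ (zdGraph 2).edgeSet → β < k₀ → k₀ + 1 ≤ k →
      ω ∈ firstHit halfPlane (rowIcc α β) k₀ k →
      ω ∉ openCrossing (halfPlane \ {bpt k}) (rowIcc α β) {bpt (k + 1)} →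
      (ω \ {s(bpt k, bpt (k + 1)), s(bpt k, ![k, 1])}) ∪ {s(![k, 1], ![k + 1, 1]), s(![k + 1, 1], bpt (k + 1))} ∈
        firstHit halfPlane (rowIcc α β) k₀ (k + 1) :=
  fun hω hβ hk hE hnI => caseII_surgery hω hβ hk hE hnI

end Setting

end TwoArmLower

end Summit.CriticalPhenomena.CardyFormulaZ2.Cruxes.HalfPlaneMarkDensityLaw.SketchLine
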